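import Summits.AtomisticToContinuum.FouriersLaw.Theorems.BoundaryEscapeDeficitBoundaryKernelBasics
import Summits.AtomisticToContinuum.FouriersLaw.Theorems.EmbeddedDrudeMourreAbelThermodynamicLimitAnchoredKuboPairCorrelations
import Summits.AtomisticToContinuum.FouriersLaw.Theses.GriffithsLimitExchange

/-!
# `GriffithsLimitExchange.KernelIntegrable` — proved

Item `stmt-AtomisticToContinuum-13203` (support, route `GriffithsLimitExchange`, sub-problem `FouriersLaw`):
for `P = pinnedChain ω₂ lam β γ` (all parameters `> 0`), `T > 0` and every `N`, the two boundary
kinetic kernels of the equilibrium chain (constructed kernels `P.transitionKernel N T T u⁺`, Gibbs state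
`P.gibbsMeasure N T`)

* `K_N(u)  = ∫ (p₀² - T) · P_{u⁺}(p₀² - T) dμ_T`      (return kernel),
* `Kt_N(u) = ∫ (p₀² - T) · P_{u⁺}(p²_{N-1} - T) dμ_T`  (transmission kernel)

are integrable on `(0, ∞)`; for `N = 0` both kernels are `0` by the route's convention.

Proof: both are equilibrium cross correlations `∫ f · P_{u⁺} g dμ_T` of continuous observables of
exponential class (`|p_i² - T| ≤ (2/ϑ + T) e^{ϑH}`, `ϑ = 1/(4T)`,
`SubdiffusiveBondHeat.abs_sq_momentum_sub_le_exp`) with a CENTRED inner observable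
(`∫ (p_i² - T) dμ_T = 0`, equipartition, `SubdiffusiveBondHeat.pinnedChain_integral_kinObs_gibbsMeasure`),
so `LoomisCompactHorizonWitness.pinnedChain_integrableOn_crossCorr` (measurability in `u` from the joint
measurability of the kernels + the exponential decay `|K(u)| ≤ C' e^{-cu}` from CEHR 2018 Thm 2.13 (3)
with the limit identified as `μ_T` by Harris uniqueness and Gibbs invariance of the constructed kernels)
applies verbatim. No Gibbs-invariance input beyond what those landed files already discharge.

References: Cuneo–Eckmann–Hairer–Rey-Bellet 2018, Thm 2.13 (3); Bonetto–Lebowitz–Rey-Bellet 2000 §5.1.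
-/

noncomputable section

open MeasureTheory ProbabilityTheory Filter Topology Set
open scoped NNReal ENNReal

namespace Summit.AtomisticToContinuum.FouriersLaw.Theorems.GriffithsLimitExchange

open Literature.MathematicalPhysics.KineticTheory.HeatConduction
open Literature.MathematicalPhysics.KineticTheory OscillatorChain
open Summit.AtomisticToContinuum.FouriersLaw.Theorems.SubdiffusiveBondHeat
open Summit.AtomisticToContinuum.FouriersLaw.Theorems.AbelThermodynamicLimit.LoomisCompactHorizonWitness

section CrossKernel

variable {ω₂ lam β γ : ℝ} (hω : 0 < ω₂) (hl : 0 ≤ lam) (hβ : 0 < β) (hγ : 0 < γ) {N : ℕ} (hN : 0 < N)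
  {T : ℝ} (hT : 0 < T)
include hω hl hβ hγ hN hT

/-- **Integrability of the boundary kinetic cross kernels**: for all momenta indices `i, j`, the
equilibrium correlation `u ↦ ∫ (p_i² - T) · P_{u⁺}(p_j² - T) dμ_T` of the pinned chain (equal bath
temperatures `T > 0`, `N ≥ 1`) is integrable on `(0, ∞)` — exponential class of `p² - T`, centring
`μ_T(p_j² - T) = 0`, and the exponential mixing of the equilibrium chain.
[cite: CuneoEckmannHairerReyBellet2018, Thm 2.13 (3)] -/
theorem pinnedChain_kinCrossCorr_integrableOn (i j : Fin N) :
    IntegrableOn (fun u : ℝ => ∫ z, (z.2 i ^ 2 - T) *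
        (∫ y, (y.2 j ^ 2 - T) ∂((pinnedChain ω₂ lam β γ).transitionKernel N T T u.toNNReal z))
      ∂((pinnedChain ω₂ lam β γ).gibbsMeasure N T)) (Ioi 0) := by
  set ϑ : ℝ := 1 / (4 * T) with hϑ
  have hϑ0 : 0 < ϑ := by positivity
  have h2ϑ : 2 * ϑ < 1 / T := by
    rw [hϑ, show 2 * (1 / (4 * T)) = 1 / (2 * T) by field_simp; ring,
      div_lt_div_iff₀ (by positivity) hT]
    nlinarith
  have hf : Continuous fun z : PhaseSpace N => z.2 i ^ 2 - T := by fun_prop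
  have hg : Continuous fun z : PhaseSpace N => z.2 j ^ 2 - T := by fun_prop
  have hfb : ∀ y : PhaseSpace N, |y.2 i ^ 2 - T| ≤
      (2 / ϑ + T) * Real.exp (ϑ * (pinnedChain ω₂ lam β γ).hamiltonian N y) := fun y =>
    abs_sq_momentum_sub_le_exp hω hl hβ.le hϑ0 hT.le y i
  have hgb : ∀ y : PhaseSpace N, |y.2 j ^ 2 - T| ≤
      (2 / ϑ + T) * Real.exp (ϑ * (pinnedChain ω₂ lam β γ).hamiltonian N y) := fun y =>
    abs_sq_momentum_sub_le_exp hω hl hβ.le hϑ0 hT.le y j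
  have h0 := pinnedChain_integral_kinObs_gibbsMeasure hω hl hβ.le γ N hT j
  exact pinnedChain_integrableOn_crossCorr hω hl hβ hγ hN hT hϑ0 h2ϑ hf hfb hg hgb h0

end CrossKernel

/-- **`GriffithsLimitExchange.KernelIntegrable`, PROVED** (item stmt-AtomisticToContinuum-13203): for the
pinned anharmonic chain with all parameters positive and `T > 0`, for every `N` the return kernel
`K_N(u) = ∫ (p₀² - T) P_{u⁺}(p₀² - T) dμ_T` and the transmission kernel
`Kt_N(u) = ∫ (p₀² - T) P_{u⁺}(p²_{N-1} - T) dμ_T` are integrable on `(0, ∞)` (`N = 0`: both are the zero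
kernel). [cite: CuneoEckmannHairerReyBellet2018, Thm 2.13 (3)] -/
theorem kernelIntegrable_proof :
    Summit.AtomisticToContinuum.FouriersLaw.Theses.GriffithsLimitExchange.KernelIntegrable := by
  intro ω₂ lam β γ hω hl hβ hγ T hT
  dsimp only
  intro N
  rcases Nat.eq_zero_or_pos N with rfl | hN
  · simp only [lt_self_iff_false, dif_neg, not_false_eq_true]
    exact ⟨integrableOn_zero, integrableOn_zero⟩
  · simp only [dif_pos hN]
    exact ⟨pinnedChain_kinCrossCorr_integrableOn hω hl.le hβ hγ hN hT ⟨0, hN⟩ ⟨0, hN⟩,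
      pinnedChain_kinCrossCorr_integrableOn hω hl.le hβ hγ hN hT ⟨0, hN⟩ ⟨N - 1, by omega⟩⟩

end Summit.AtomisticToContinuum.FouriersLaw.Theorems.GriffithsLimitExchange

end
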